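import Literature.AnabelianGeometry.AbsoluteAnabelian.MLFGaloisIntrinsic
import Mathlib.FieldTheory.Galois.Infinite
import Mathlib.Topology.Algebra.OpenSubgroup
import Mathlib.Topology.Algebra.Group.ClosedSubgroup

/-!
# [AbsTopIII] Rmk 3.1.1 at the level cut out by a finite-index (e.g. open, for compact `Π_k`) subgroup

Proof-only companion (no definitions) of `MLFGaloisModel.lean` / `MLFGaloisIntrinsic.lean` (seat
abc-iut-L4-t2; S. Mochizuki, *Topics in absolute anabelian geometry III*, §3, Def. 3.1 (i)–(iii)
pp. 66–68, Rmk. 3.1.1 p. 70; bib key `MochizukiAbsTopIII2015`, lit key `paper:url-5493eb38cbb7`).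

Def. 3.1 (iii) p. 68 says the passages `k̄ ↦ 𝒪_k̄^⊳` and `k̄^× ↦ 𝒪_k̄^×` are "intrinsically defined", via
"the elements `a ∈ k̄^×` such that `a^{-n}` fails to converge to `0`" resp. "the maximal compact subgroups
of the subgroups of the arithmetic data obtained as subgroups of invariants for various open subgroups
of the Galois group" — i.e. via the topology at the FINITE levels; Rmk. 3.1.1 p. 70 replaces the
topology by divisibility ("the subgroup of elements divisible by arbitrary powers of some prime
number").  To make the natural functors `𝒞_TF → 𝒞_TM`, `𝒞_TLG → 𝒞_TCG` act on MORPHISMS of pairs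
(Def. 3.1 (ii): `φ_Π` "induces an open injective homomorphism between the respective arithmetic
Galois groups", typed as: the saturation `φ_Π(U)·Ker` of every open subgroup `U` is open in the TARGET
`Π`), one needs Rmk. 3.1.1 at the level cut out by an arbitrary open subgroup `H ⊆ Π_k`, which is a
finite extension of `k` as soon as `H` has finite index in `Π_k` — e.g. `Π_k` compact, or the
arithmetic quotient compact — (then `ε_k(H) ⊆ G_k` has finite index, so its closure is open).  This
file proves exactly that:

* `MLFClosure.mem_unitSubmonoid_of_forall_exists_pow_eq_mem` — Rmk. 3.1.1 at an arbitrary finite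
  level `E/k`: `x ∈ E`, `x ≠ 0`, with `ℓ^n`-th roots IN `E` for all `n` ⟹ `x ∈ 𝒪_k̄^×`
  (the level `E = k(x)` is the tree's `mem_unitSubmonoid_iff_exists_prime_forall_exists_pow_eq`);
* `MLFClosure.exists_finiteDimensional_of_finiteIndex` — a finite-index subgroup `B ⊆ G_k` fixes only
  elements of a finite extension of `k` (closure of `B` is open; Krull);
* `ModelMLFGaloisData.exists_finiteDimensional_of_finiteIndex` — the elements of `k̄` fixed (through
  `ε_k`) by a FINITE-INDEX subgroup `H ⊆ Π_k` lie in a finite extension of `k` (universe-polymorphic; a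
  universe-`0` twin with hypothesis `(H.map ε_k).FiniteIndex` is abc-iut-w4-d007's
  `CohomologySystemOfContH1.exists_finiteDimensional_forall_mem_of_fixed` in the L6 file
  `IUT/HodgeArakelov/CohomologyLimitKummerMLF.lean`, not importable here without fixing the universe);
  finite index is what an open subgroup has when `Π_k` is compact (compact discrete coset space; the
  tree's universe-`0` `GaloisRepresentations.finiteIndex_of_isOpen_of_compactSpace`) or, more generally,
  when it contains a normal subgroup `N` with `Π_k/N` compact — e.g. the arithmetic kernel, for a compact
  arithmetic Galois group (`finiteIndex_of_isOpen_of_compactSpace_quotient`);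
* `ModelMLFGaloisData.mem_unitSubmonoid_of_forall_exists_pow_eq_fixed` — hence: `x ≠ 0` with, for some
  prime `ℓ` and all `n`, an `ℓ^n`-th root fixed by a finite-index `H` ⟹ `x ∈ 𝒪_k̄^×`
  (`fieldPair_isIntrinsicUnit_of_forall_exists_pow_eq_fixed`: the same as an intrinsic unit of the
  model `TF`-pair `(Π_k ↷ k̄)` of `MLFGaloisIntrinsic`).

HONEST FRAMING: OUR kernel checks of classical valuation/Galois theory quoted by a refereed 2015 paper;
nothing here bears on [IUTchIII] Cor. 3.12.
-/

noncomputable section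

namespace Literature.AnabelianGeometry.AbsoluteAnabelian

open _root_.ValuativeRel
open Literature.NumberTheory.GaloisRepresentations

universe u

/-! ### Finite index of open subgroups (topological groups) -/

section FiniteIndex

variable {G : Type u} [Group G] [TopologicalSpace G] [IsTopologicalGroup G]

/-- An open subgroup `H` containing a normal subgroup `N` with COMPACT quotient `G/N` has finite index
(the image of `H` in the compact group `G/N` is open, hence — its coset space being compact and
discrete — of finite index, Ribes–Zalesskii Lemma 2.1.2; and `H` is the preimage of its image).  For a
pair `(Π ↷ M)` with `N` the arithmetic kernel this is the case of a compact arithmetic Galois group; with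
`N = ⊥` it is the case of a compact `Π` (for which the tree also has the universe-`0`
`GaloisRepresentations.finiteIndex_of_isOpen_of_compactSpace`). [cite: RibesZalesskii2010, Lemma 2.1.2] -/
theorem finiteIndex_of_isOpen_of_compactSpace_quotient (N : Subgroup G) [N.Normal]
    [CompactSpace (G ⧸ N)] (H : Subgroup G) (hNH : N ≤ H) (hH : IsOpen (H : Set G)) :
    H.FiniteIndex := by
  have hopen : IsOpen ((H.map (QuotientGroup.mk' N) : Subgroup (G ⧸ N)) : Set (G ⧸ N)) :=
    QuotientGroup.isOpenMap_coe _ hH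
  haveI : Finite ((G ⧸ N) ⧸ H.map (QuotientGroup.mk' N)) :=
    Subgroup.quotient_finite_of_isOpen _ hopen
  haveI : (H.map (QuotientGroup.mk' N)).FiniteIndex := Subgroup.finiteIndex_of_finite_quotient
  have hcomap : (H.map (QuotientGroup.mk' N)).comap (QuotientGroup.mk' N) = H := by
    rw [Subgroup.comap_map_eq, QuotientGroup.ker_mk', sup_eq_left.mpr hNH]
  rw [Subgroup.finiteIndex_iff, ← hcomap,
    Subgroup.index_comap_of_surjective _ (QuotientGroup.mk'_surjective N)]
  exact Subgroup.FiniteIndex.index_ne_zero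

end FiniteIndex

/-! ### Rmk 3.1.1 at a finite level; finite-index subgroups of `G_k` -/

namespace MLFClosure

variable (C : MLFClosure.{u})

/-- **Rmk 3.1.1 at an arbitrary finite level**: if `x ≠ 0` lies in a finite extension `E` of `k`
inside `k̄` and has, for some prime `ℓ`, an `ℓ^n`-th root in `E` for every `n`, then `x ∈ 𝒪_k̄^×`
(`E` is a local field for the prolonged valuation, in which infinitely `ℓ`-divisible elements have
valuation `1`; valuation `1` in `E` means `x`, `x⁻¹` integral over `𝒪_k`).
[cite: MochizukiAbsTopIII2015, Remark 3.1.1 p.70] -/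
theorem mem_unitSubmonoid_of_forall_exists_pow_eq_mem (E : IntermediateField C.k C.K)
    [FiniteDimensional C.k E] {x : C.K} (hx0 : x ≠ 0) (hxE : x ∈ E) {ℓ : ℕ} (hℓ : ℓ.Prime)
    (h : ∀ n : ℕ, ∃ y ∈ E, y ^ (ℓ ^ n) = x) : x ∈ unitSubmonoid C.k C.K := by
  letI := FiniteExtension.valuativeRel C.k E
  letI := FiniteExtension.topologicalSpace C.k E
  haveI := FiniteExtension.isNonarchimedeanLocalField C.k E
  set xE : E := ⟨x, hxE⟩ with hxEdef
  have hxE0 : xE ≠ 0 := fun h0 => hx0 (by simpa [hxEdef] using congrArg Subtype.val h0)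
  have hdiv : ∃ ℓ : ℕ, ℓ.Prime ∧ ∀ n : ℕ, ∃ y : E, y ^ ℓ ^ n = xE := by
    refine ⟨ℓ, hℓ, fun n => ?_⟩
    obtain ⟨y, hyE, hy⟩ := h n
    exact ⟨⟨y, hyE⟩, Subtype.ext (by simpa [hxEdef] using hy)⟩
  have hv : valuation (E : Type u) xE = 1 :=
    (IsNonarchimedeanLocalField.valuation_eq_one_iff_exists_prime_forall_exists_pow_eq
      (E : Type u) hxE0).mpr hdiv
  obtain ⟨hi, hii⟩ :=
    (FiniteExtension.valuation_eq_one_iff_isIntegral_and_isIntegral_inv C.k E hxE0).mp hv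
  rw [mem_unitSubmonoid_iff]
  refine ⟨hx0, (IntermediateField.isIntegral_coe_iff C.k C.K E xE).mpr hi, ?_⟩
  have hinv := (IntermediateField.isIntegral_coe_iff C.k C.K E xE⁻¹).mpr hii
  simpa [hxEdef] using hinv

/-- **A finite-index subgroup of `G_k` fixes only a finite extension of `k`**: if `B ⊆ G_k` has finite
index, there is a finite extension `E/k` inside `k̄` containing every element fixed by `B` (the
closure of `B` is closed of finite index, hence open, and its fixed field is finite over `k` by the
Galois correspondence for open subgroups; stabilisers being closed, `B`-fixed elements are fixed by
the closure). [cite: MochizukiAbsTopIII2015, Definition 3.1 (i) p.66] -/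
theorem exists_finiteDimensional_of_finiteIndex (B : Subgroup (C.K ≃ₐ[C.k] C.K)) [B.FiniteIndex] :
    ∃ E : IntermediateField C.k C.K, FiniteDimensional C.k E ∧
      ∀ x : C.K, (∀ σ ∈ B, σ x = x) → x ∈ E := by
  let Bc : ClosedSubgroup (C.K ≃ₐ[C.k] C.K) :=
    ⟨B.topologicalClosure, B.isClosed_topologicalClosure⟩
  haveI : Bc.toSubgroup.FiniteIndex := Subgroup.finiteIndex_of_le B.le_topologicalClosure
  have hopen : IsOpen (Bc.toSubgroup : Set (C.K ≃ₐ[C.k] C.K)) :=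
    Bc.toSubgroup.isOpen_of_isClosed_of_finiteIndex Bc.isClosed'
  refine ⟨IntermediateField.fixedField Bc.toSubgroup, ?_, ?_⟩
  · rw [← InfiniteGalois.isOpen_iff_finite, InfiniteGalois.fixingSubgroup_fixedField Bc]
    exact hopen
  · intro x hx
    rw [IntermediateField.mem_fixedField_iff]
    intro σ hσ
    -- the stabiliser of `x` is open (it contains the open fixing subgroup of `k(x)`), hence closed
    have hop : IsOpen (MulAction.stabilizer (C.K ≃ₐ[C.k] C.K) x : Set (C.K ≃ₐ[C.k] C.K)) := by
      haveI : FiniteDimensional C.k (IntermediateField.adjoin C.k ({x} : Set C.K)) :=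
        IntermediateField.adjoin.finiteDimensional (Algebra.IsAlgebraic.isAlgebraic x).isIntegral
      refine Subgroup.isOpen_mono ?_
        (IntermediateField.fixingSubgroup_isOpen (IntermediateField.adjoin C.k ({x} : Set C.K)))
      intro τ hτ
      exact (IntermediateField.mem_fixingSubgroup_iff _ _).mp hτ x
        (IntermediateField.mem_adjoin_simple_self C.k x)
    have hcl : IsClosed (MulAction.stabilizer (C.K ≃ₐ[C.k] C.K) x : Set (C.K ≃ₐ[C.k] C.K)) :=
      Subgroup.isClosed_of_isOpen _ hop
    have hle : B.topologicalClosure ≤ MulAction.stabilizer (C.K ≃ₐ[C.k] C.K) x :=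
      B.topologicalClosure_minimal (fun τ hτ => hx τ hτ) hcl
    exact hle hσ

end MLFClosure

/-! ### Finite-index subgroups of `Π_k`: the level they cut out, and Rmk 3.1.1 there -/

namespace ModelMLFGaloisData

variable (C : MLFClosure.{u}) (D : ModelMLFGaloisData C.k C.K)

/-- **A finite-index subgroup of `Π_k` cuts out a finite level**: the elements of `k̄` fixed (through
`ε_k`) by a subgroup `H ⊆ Π_k` of finite index lie in a finite extension of `k` (`ε_k(H)` has finite
index in `G_k`).  Open subgroups have finite index when `Π_k` — or just the arithmetic quotient — is
compact (`finiteIndex_of_isOpen_of_compactSpace_quotient`).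
[cite: MochizukiAbsTopIII2015, Definition 3.1 (i) p.66] -/
theorem exists_finiteDimensional_of_finiteIndex (H : Subgroup D.Pi) [H.FiniteIndex] :
    ∃ E : IntermediateField C.k C.K, FiniteDimensional C.k E ∧
      ∀ x : C.K, (∀ g ∈ H, D.aug g • x = x) → x ∈ E := by
  haveI : (H.map D.aug).FiniteIndex := by
    rw [Subgroup.finiteIndex_iff]
    intro h0
    have hdvd := Subgroup.index_map_dvd H D.aug_surjective
    rw [h0, zero_dvd_iff] at hdvd
    exact Subgroup.FiniteIndex.index_ne_zero hdvd
  obtain ⟨E, hE, hfix⟩ := C.exists_finiteDimensional_of_finiteIndex (H.map D.aug)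
  refine ⟨E, hE, fun x hx => hfix x fun σ hσ => ?_⟩
  obtain ⟨g, hg, rfl⟩ := Subgroup.mem_map.mp hσ
  exact hx g hg

/-- **Rmk 3.1.1 at the level of a finite-index subgroup of `Π_k`**: if `H ⊆ Π_k` has finite index and
`x ∈ k̄`, `x ≠ 0`, admits for some prime `ℓ` and every `n` an `ℓ^n`-th root fixed by `H`, then
`x ∈ 𝒪_k̄^×` ("the subgroup of elements divisible by arbitrary powers of some prime number", read in
the finite extension of `k` cut out by `H`). [cite: MochizukiAbsTopIII2015, Remark 3.1.1 p.70] -/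
theorem mem_unitSubmonoid_of_forall_exists_pow_eq_fixed (H : Subgroup D.Pi) [H.FiniteIndex]
    {x : C.K} (hx0 : x ≠ 0) {ℓ : ℕ} (hℓ : ℓ.Prime)
    (h : ∀ n : ℕ, ∃ y : C.K, (∀ g ∈ H, D.aug g • y = y) ∧ y ^ (ℓ ^ n) = x) :
    x ∈ unitSubmonoid C.k C.K := by
  obtain ⟨E, hE, hfix⟩ := D.exists_finiteDimensional_of_finiteIndex C H
  haveI := hE
  have hxE : x ∈ E := by
    obtain ⟨y, hy, hyx⟩ := h 0
    rw [pow_zero, pow_one] at hyx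
    subst hyx
    exact hfix y hy
  exact C.mem_unitSubmonoid_of_forall_exists_pow_eq_mem E hx0 hxE hℓ fun n => by
    obtain ⟨y, hy, hyx⟩ := h n
    exact ⟨y, hfix y hy, hyx⟩

/-- The same in the language of the model `TF`-pair `(Π_k ↷ k̄)` and of `MLFGaloisIntrinsic`: an
element with, for some prime `ℓ` and all `n`, an `ℓ^n`-th root fixed by a finite-index subgroup of
`Π_k` is an INTRINSIC UNIT of `(Π_k ↷ k̄)`. [cite: MochizukiAbsTopIII2015, Remark 3.1.1 p.70] -/
theorem fieldPair_isIntrinsicUnit_of_forall_exists_pow_eq_fixed (H : Subgroup D.fieldPair.Pi)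
    [H.FiniteIndex] {x : D.fieldPair.M} (hx0 : x ≠ 0) {ℓ : ℕ} (hℓ : ℓ.Prime)
    (h : ∀ n : ℕ, ∃ y : D.fieldPair.M, (∀ g ∈ H, g • y = y) ∧ y ^ (ℓ ^ n) = x) :
    D.fieldPair.IsIntrinsicUnit x :=
  (D.isIntrinsicUnit_fieldPair_iff C x).mpr
    (@ModelMLFGaloisData.mem_unitSubmonoid_of_forall_exists_pow_eq_fixed C D H ‹_› x hx0 ℓ hℓ h)

end ModelMLFGaloisData

end Literature.AnabelianGeometry.AbsoluteAnabelian

end
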